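import Summits.BirchSwinnertonDyer.BirchSwinnertonDyer.Theorems.ResidualThetaTransportAtTwoThetaLayerLambdaCongruenceAtTwoCuspSpanRowInductionOdd
import Summits.BirchSwinnertonDyer.BirchSwinnertonDyer.Theorems.ResidualThetaTransportAtTwoSignedMuVanishingAtTwoPlusCuspSpanNamed
import Summits.BirchSwinnertonDyer.BirchSwinnertonDyer.Theses.ResidualThetaTransportAtTwo
import HarnessLib

/-!
# Route `ResidualThetaTransportAtTwo` (and `ThetaPartnerAtTwo`): the shared node item stmt-BirchSwinnertonDyer-27436
# `CuspSpanEvenAtTwoOdd` — PROVED; FLAT for every odd conductor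

Cell `bsd-wall`, width seat `bsd-wall-rtt-p3-w2` g5 (2026-08-28). THEOREMS ONLY; BSD is not proved by this.

The route declaration `CuspSpanEvenAtTwoOdd` is `∀ N, ¬ 2 ∣ N → SignedMuAtTwo.CuspSpanEvenAtTwo N` inlined — the node (G′)_N at every
odd level: every additive, period-invariant `χ : Γ₀(N) → 𝔽₂` killing the `|d| = 4^k` elements is `ψ ∘ (lower-right entry mod N)`
with `ψ` multiplicative on units (dually: the even `2`-power cusp classes span the kernel of the Shimura-quotient map on
`H₁(X₀(N); 𝔽₂)`). It holds at every odd `N` by `SignedMuAtTwo.Rows.cuspSpanEvenAtTwo_of_not_two_dvd` (`…CuspSpanRowInductionOdd`):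
the all-odd-rows induction of the cell's line `birth` (memo `Cruxes/ThetaLayerLambdaCongruenceAtTwo/Lines/birth-rows-allodd.md`,
w4 g2: row character `…CuspSpanRowConjugation`, relations `…CuspSpanRowRelations`, step `…CuspSpanRowInduction`, over the level-`N`
three-fold `B₁`-relations `…CuspSpanCharacterOdd` / `…CuspSpanTriangleNRelation` / `…CuspSpanFourInvarianceOdd` of w2 g4 / w4 g2 /
w5 g2), the case `3 ∣ N` (`…CuspSpanRowInductionThree`) and the parity assembly (`…CuspSpanRowInductionOdd`), this seat.
* `CuspSpanEvenAtTwoOdd_proof` — the route declaration, by name (closes item 27436). Consumers by name: the glue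
  `ThetaLayerLambdaCongruenceAtTwoGlue` (Kan⁺ 20688 ⟸ `PublishedInputsHeckeAtTwo` ∧ this, p626153), K1 `MazurTateCongruenceAtTwoTop`
  (glue 27437), Kμ⁺-an 21437 (`…SignedMuVanishingAtTwoPlusLineV46`).
* `SignedMuAtTwo.flatAtTwo_of_conductor_odd` — FLAT (`2 ∤ L⁻` for every Pollack pair) for every `W/ℚ` good supersingular at `2` with
  `a₂(W) = 0` and odd conductor (one line over `flatAtTwo_of_cuspSpanEvenAtTwo`).

References: [Rademacher1929] §1; [Pollack2003] Conj. 6.3, Prop. 6.18.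
-/

set_option autoImplicit false
-- justification: the `Summit.BirchSwinnertonDyer.BirchSwinnertonDyer.…` path repeats a component (route-file convention)
set_option linter.dupNamespace false

noncomputable section

open scoped MatrixGroups

open CongruenceSubgroup WeierstrassCurve Literature.NumberTheory.EllipticCurves
  Literature.NumberTheory.EllipticCurves.ModularForms Literature.NumberTheory.EllipticCurves.Rank1Residual
  Literature.NumberTheory.IwasawaTheory Summit.BirchSwinnertonDyer.Rank1Residual.Supersingular

namespace Summit.BirchSwinnertonDyer.BirchSwinnertonDyer.Theorems

/-- **Item stmt-BirchSwinnertonDyer-27436 `CuspSpanEvenAtTwoOdd` holds**: the node (G′)_N = `SignedMuAtTwo.CuspSpanEvenAtTwo N` at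
every odd level `N`. [cite: Pollack2003, Conj. 6.3] -/
theorem CuspSpanEvenAtTwoOdd_proof :
    Summit.BirchSwinnertonDyer.BirchSwinnertonDyer.Theses.ResidualThetaTransportAtTwo.CuspSpanEvenAtTwoOdd := by
  intro N _ h2
  have h := SignedMuAtTwo.Rows.cuspSpanEvenAtTwo_of_not_two_dvd N h2
  rw [SignedMuAtTwo.cuspSpanEvenAtTwo_iff] at h
  exact h

namespace SignedMuAtTwo

/-- **FLAT for every odd conductor.** For `W/ℚ` good supersingular at `2` with `a₂(W) = 0`, newform `f`, and odd conductor `N_W`: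
`2 ∤ L⁻` for every Pollack pair `(L⁺, L⁻)` of `f` at `2` (the node at level `N_W` + `flatAtTwo_of_cuspSpanEvenAtTwo`).
BSD is not proved by this. [cite: Pollack2003, Conj. 6.3 and Prop. 6.18] -/
theorem flatAtTwo_of_conductor_odd {W : WeierstrassCurve ℚ} [W.IsElliptic] [W.IsGloballyMinimal]
    [NeZero (W.conductorNorm ℤ)] {f : CuspForm (Gamma0 (W.conductorNorm ℤ)) 2}
    (hf : IsNewformOf W f) (hss : GoodSS W 2) (ha2 : W.frobeniusTrace 2 = 0) (hodd : Odd (W.conductorNorm ℤ)) :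
    ∀ Lplus Lminus : IwasawaAlgebra 2, IsPollackPair f 2 Lplus Lminus → ¬ PowerSeries.C (2 : ℤ_[2]) ∣ Lminus :=
  flatAtTwo_of_cuspSpanEvenAtTwo hf hss ha2 (Rows.cuspSpanEvenAtTwo_oddLevel hodd)

end SignedMuAtTwo

end Summit.BirchSwinnertonDyer.BirchSwinnertonDyer.Theorems

end
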